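import Mathlib
import HarnessLib

/-!
# Closed forms and crude bounds for the piece integrals of the Weil ground-state cap

Stub `stub_pieceIntegrals` for the line *parity–multiplicity–commutator* of the crux
`GroundStateSimpleEven` (Weil ground state).  The lead evaluates `∫₀^{u₁} E(u) · m(u/c) du`
where `E` is a step cap (an even sextic on `[0, 7/5]`, constants on panels) and `m` expands into
`log u + const ± C/(A + u²)`; every piece is one of the five shapes below:

1. `∫_a^b log u = (b log b − b) − (a log a − a)` (Mathlib's `integral_log`, rearranged);
2. `∫_ε^B u^k log u = [u^{k+1} log u/(k+1) − u^{k+1}/(k+1)²]_ε^B` for `0 < ε ≤ B`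
   (fundamental theorem of calculus with the displayed primitive);
3. `−ε²/3 ≤ ∫₀^ε p(u) log u` for the cap `p(u) = 2u²/3 − 2u⁴/15 + 4u⁶/315` and `0 < ε ≤ 1`:
   on `(0, 1]`, `0 ≤ p(u) ≤ 2u²/3`, `log u ≤ 0` and `log u ≥ 1 − 1/u`, so
   `p(u) log u ≥ (2/3) u² log u ≥ (2/3)(u² − u) ≥ −(2/3) u`, and `∫₀^ε −(2/3) u = −ε²/3`;
4. `∫₀^B u^{2,4,6}/(A + u²)` for `A = r²`, `r > 0`, by the fundamental theorem of calculus with the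
   primitives `u − r arctan(u/r)`, `u³/3 − A u + A r arctan(u/r)`,
   `u⁵/5 − A u³/3 + A² u − A² r arctan(u/r)`;
5. for `0 ≤ a ≤ b`, `A > 0`, `C ≥ 0` the Lorentzian `C/(A + u²)` is monotone decreasing on `[a, b]`,
   whence `(b − a) C/(A + b²) ≤ ∫_a^b C/(A + u²) ≤ (b − a) C/(A + a²)`.
-/

open Set MeasureTheory Filter

open scoped Real Topology

namespace Summit.RiemannHypothesis.RiemannHypothesis.Theorems

namespace GroundStateSimpleEven

set_option linter.dupNamespace false in
/-- `∫_a^b log u = (b log b − b) − (a log a − a)`: Mathlib's `integral_log`, rearranged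
(no positivity hypothesis is needed since `log` is integrable at `0`). [folklore] -/
lemma pieces_integral_log (a b : ℝ) :
    ∫ u in a..b, Real.log u = (b * Real.log b - b) - (a * Real.log a - a) := by
  rw [integral_log]
  ring

set_option linter.dupNamespace false in
/-- `∫_ε^B u^k log u = [u^{k+1} log u/(k+1) − u^{k+1}/(k+1)²]_ε^B` for `0 < ε ≤ B`: the bracket
has derivative `u^k log u + u^k/(k+1) − u^k/(k+1) = u^k log u` on `(0, ∞)`, and the integrand is
continuous on `[ε, B]`. [folklore] -/
lemma pieces_integral_pow_mul_log {ε B : ℝ} (hε : 0 < ε) (hεB : ε ≤ B) (k : ℕ) :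
    ∫ u in ε..B, u ^ k * Real.log u =
      (B ^ (k + 1) * Real.log B / (k + 1) - B ^ (k + 1) / (k + 1) ^ 2) -
        (ε ^ (k + 1) * Real.log ε / (k + 1) - ε ^ (k + 1) / (k + 1) ^ 2) := by
  have hk : (k : ℝ) + 1 ≠ 0 := by positivity
  have hpos : ∀ x ∈ uIcc ε B, 0 < x := fun x hx => by
    rw [uIcc_of_le hεB] at hx
    exact hε.trans_le hx.1
  refine intervalIntegral.integral_eq_sub_of_hasDerivAt
    (f := fun u => u ^ (k + 1) * Real.log u / (k + 1) - u ^ (k + 1) / (k + 1) ^ 2)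
    (fun x hx => ?_) ?_
  · have hx0 : x ≠ 0 := (hpos x hx).ne'
    have hpk : HasDerivAt (fun y : ℝ => y ^ (k + 1)) (((k : ℝ) + 1) * x ^ k) x := by
      simpa using hasDerivAt_pow (k + 1) x
    have h := ((hpk.fun_mul (Real.hasDerivAt_log hx0)).div_const ((k : ℝ) + 1)).fun_sub
      (hpk.div_const (((k : ℝ) + 1) ^ 2))
    convert h using 1
    have hxk : x ^ (k + 1) * x⁻¹ = x ^ k := by
      rw [pow_succ, mul_assoc, mul_inv_cancel₀ hx0, mul_one]
    rw [hxk]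
    field_simp
    ring
  · refine ContinuousOn.intervalIntegrable ?_
    refine (continuousOn_pow k).mul (Real.continuousOn_log.mono fun x hx => ?_)
    exact (hpos x hx).ne'

set_option linter.dupNamespace false in
/-- Small-`u` tail of the cap against the logarithm: for `0 < ε ≤ 1`,
`−ε²/3 ≤ ∫₀^ε (2u²/3 − 2u⁴/15 + 4u⁶/315) log u`.  On `(0, 1]` the cap lies in `[0, 2u²/3]`
(`u⁶ ≤ u⁴`), `log u ≤ 0` and `1 − 1/u ≤ log u` (`Real.one_sub_inv_le_log_of_pos`), so the
integrand is `≥ (2/3) u² log u ≥ (2/3)(u² − u) ≥ −(2/3) u`, whose integral is `−ε²/3`; the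
integrand is (continuous) · (`log`, integrable at `0`). [folklore] -/
lemma pieces_capLog_tail_ge {ε : ℝ} (hε : 0 < ε) (hε1 : ε ≤ 1) :
    -(ε ^ 2 / 3) ≤ ∫ u in (0 : ℝ)..ε,
      (2 / 3 * u ^ 2 - 2 / 15 * u ^ 4 + 4 / 315 * u ^ 6) * Real.log u := by
  have hlow : ∫ u in (0 : ℝ)..ε, -(2 / 3) * u = -(ε ^ 2 / 3) := by
    rw [intervalIntegral.integral_const_mul, integral_id]
    ring
  rw [← hlow]
  refine intervalIntegral.integral_mono_on_of_le_Ioo hε.le ?_ ?_ fun u hu => ?_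
  · exact (continuous_const.mul continuous_id).intervalIntegrable _ _
  · exact intervalIntegral.intervalIntegrable_log'.continuousOn_mul (by fun_prop)
  · obtain ⟨hu0, huε⟩ := hu
    have hu1 : u ≤ 1 := (huε.le.trans hε1)
    have hlog0 : Real.log u ≤ 0 := Real.log_nonpos hu0.le hu1
    have hlog1 : 1 - u⁻¹ ≤ Real.log u := Real.one_sub_inv_le_log_of_pos hu0
    have h64 : u ^ 6 ≤ u ^ 4 := pow_le_pow_of_le_one hu0.le hu1 (by norm_num)
    have h4 : 0 ≤ u ^ 4 := by positivity
    have hp : 2 / 3 * u ^ 2 - 2 / 15 * u ^ 4 + 4 / 315 * u ^ 6 - 2 / 3 * u ^ 2 ≤ 0 := by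
      linarith
    have hkey : 2 / 3 * u ^ 2 * Real.log u ≤
        (2 / 3 * u ^ 2 - 2 / 15 * u ^ 4 + 4 / 315 * u ^ 6) * Real.log u := by
      have := mul_nonneg_of_nonpos_of_nonpos hp hlog0
      linarith
    have hsq : u ^ 2 * (1 - u⁻¹) ≤ u ^ 2 * Real.log u :=
      mul_le_mul_of_nonneg_left hlog1 (by positivity)
    have hid : u ^ 2 * (1 - u⁻¹) = u ^ 2 - u := by
      field_simp
    nlinarith [hkey, hsq, hid, sq_nonneg u]

set_option linter.dupNamespace false in
/-- Derivative of `u ↦ arctan (u / r)` for `r > 0`: `r / (r² + u²)`. [folklore] -/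
lemma pieces_hasDerivAt_arctan_div {r : ℝ} (hr : 0 < r) (u : ℝ) :
    HasDerivAt (fun u => Real.arctan (u / r)) (r / (r ^ 2 + u ^ 2)) u := by
  have h := ((hasDerivAt_id' (x := u)).div_const r).arctan
  convert h using 1
  have hr0 : r ≠ 0 := hr.ne'
  have hden : r ^ 2 + u ^ 2 ≠ 0 := by positivity
  field_simp

set_option linter.dupNamespace false in
/-- The even Lorentzian moments on `[0, B]` for `A = r²`, `r > 0`:
`∫₀^B u²/(A+u²) = B − r arctan(B/r)`, `∫₀^B u⁴/(A+u²) = B³/3 − A B + A r arctan(B/r)`,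
`∫₀^B u⁶/(A+u²) = B⁵/5 − A B³/3 + A² B − A² r arctan(B/r)`, by the fundamental theorem of
calculus (the displayed right-hand sides, as functions of `B`, are primitives vanishing at `0`).
[folklore] -/
lemma pieces_integral_lorentzMoments {A r B : ℝ} (hr : 0 < r) (hA : r ^ 2 = A) :
    (∫ u in (0 : ℝ)..B, u ^ 2 / (A + u ^ 2) = B - r * Real.arctan (B / r)) ∧
      (∫ u in (0 : ℝ)..B, u ^ 4 / (A + u ^ 2) =
        B ^ 3 / 3 - A * B + A * r * Real.arctan (B / r)) ∧
      (∫ u in (0 : ℝ)..B, u ^ 6 / (A + u ^ 2) =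
        B ^ 5 / 5 - A * B ^ 3 / 3 + A ^ 2 * B - A ^ 2 * r * Real.arctan (B / r)) := by
  subst hA
  have hden : ∀ u : ℝ, r ^ 2 + u ^ 2 ≠ 0 := fun u => by positivity
  have harc := pieces_hasDerivAt_arctan_div hr
  have hint : ∀ n : ℕ, IntervalIntegrable (fun u : ℝ => u ^ n / (r ^ 2 + u ^ 2)) volume 0 B :=
    fun n => ((continuous_pow n).div (by fun_prop) hden).intervalIntegrable _ _
  have hp3 : ∀ u : ℝ, HasDerivAt (fun x : ℝ => x ^ 3) (3 * u ^ 2) u := fun u => by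
    simpa using hasDerivAt_pow 3 u
  have hp5 : ∀ u : ℝ, HasDerivAt (fun x : ℝ => x ^ 5) (5 * u ^ 4) u := fun u => by
    simpa using hasDerivAt_pow 5 u
  -- the three primitives and their derivatives
  have hd2 : ∀ u : ℝ, HasDerivAt (fun u => u - r * Real.arctan (u / r))
      (u ^ 2 / (r ^ 2 + u ^ 2)) u := fun u => by
    have h := (hasDerivAt_id' (x := u)).fun_sub ((harc u).const_mul r)
    refine h.congr_deriv ?_
    field_simp [hden u]
    ring
  have hd4 : ∀ u : ℝ, HasDerivAt (fun u => u ^ 3 / 3 - r ^ 2 * u + r ^ 2 * r * Real.arctan (u / r))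
      (u ^ 4 / (r ^ 2 + u ^ 2)) u := fun u => by
    have h := (((hp3 u).div_const 3).fun_sub ((hasDerivAt_id' (x := u)).const_mul (r ^ 2))).fun_add
      ((harc u).const_mul (r ^ 2 * r))
    refine h.congr_deriv ?_
    field_simp [hden u]
    ring
  have hd6 : ∀ u : ℝ, HasDerivAt (fun u => u ^ 5 / 5 - r ^ 2 * u ^ 3 / 3 + (r ^ 2) ^ 2 * u -
      (r ^ 2) ^ 2 * r * Real.arctan (u / r)) (u ^ 6 / (r ^ 2 + u ^ 2)) u := fun u => by
    have h := ((((hp5 u).div_const 5).fun_sub (((hp3 u).const_mul (r ^ 2)).div_const 3)).fun_add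
      ((hasDerivAt_id' (x := u)).const_mul ((r ^ 2) ^ 2))).fun_sub
      ((harc u).const_mul ((r ^ 2) ^ 2 * r))
    refine h.congr_deriv ?_
    field_simp [hden u]
    ring
  refine ⟨?_, ?_, ?_⟩
  · rw [intervalIntegral.integral_eq_sub_of_hasDerivAt (fun u _ => hd2 u) (hint 2)]
    simp only [zero_div, Real.arctan_zero]
    ring
  · rw [intervalIntegral.integral_eq_sub_of_hasDerivAt (fun u _ => hd4 u) (hint 4)]
    simp only [zero_div, Real.arctan_zero]
    ring
  · rw [intervalIntegral.integral_eq_sub_of_hasDerivAt (fun u _ => hd6 u) (hint 6)]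
    simp only [zero_div, Real.arctan_zero]
    ring

set_option linter.dupNamespace false in
/-- Monotone bounds for a Lorentzian window: for `0 ≤ a ≤ b`, `A > 0`, `C ≥ 0`, the integrand
`C/(A + u²)` decreases on `[a, b]`, so `(b − a) C/(A + b²) ≤ ∫_a^b C/(A + u²) ≤ (b − a) C/(A + a²)`
(`intervalIntegral.integral_mono_on` against constants). [folklore] -/
lemma pieces_lorentzWindow_bounds {a b C A : ℝ} (ha : 0 ≤ a) (hab : a ≤ b) (hA : 0 < A)
    (hC : 0 ≤ C) :
    (∫ u in a..b, C / (A + u ^ 2) ≤ (b - a) * (C / (A + a ^ 2))) ∧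
      ((b - a) * (C / (A + b ^ 2)) ≤ ∫ u in a..b, C / (A + u ^ 2)) := by
  have hint : IntervalIntegrable (fun u : ℝ => C / (A + u ^ 2)) volume a b :=
    (continuous_const.div (by fun_prop) fun u => by positivity).intervalIntegrable _ _
  constructor
  · calc ∫ u in a..b, C / (A + u ^ 2) ≤ ∫ _ in a..b, C / (A + a ^ 2) :=
          intervalIntegral.integral_mono_on hab hint intervalIntegrable_const fun u hu =>
            div_le_div_of_nonneg_left hC (by positivity)
              (by linarith [pow_le_pow_left₀ ha hu.1 2])
      _ = (b - a) * (C / (A + a ^ 2)) := by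
          rw [intervalIntegral.integral_const, smul_eq_mul]
  · calc (b - a) * (C / (A + b ^ 2)) = ∫ _ in a..b, C / (A + b ^ 2) := by
          rw [intervalIntegral.integral_const, smul_eq_mul]
      _ ≤ ∫ u in a..b, C / (A + u ^ 2) :=
          intervalIntegral.integral_mono_on hab intervalIntegrable_const hint fun u hu =>
            div_le_div_of_nonneg_left hC (by positivity)
              (by linarith [pow_le_pow_left₀ (ha.trans hu.1) hu.2 2])

end GroundStateSimpleEven

set_option linter.dupNamespace false in
/-- **(PIECES) Closed forms and crude bounds for the piece integrals.**
(1) `∫_a^b log u = (b log b − b) − (a log a − a)`; (2) `∫_ε^B u^k log u =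
[u^{k+1} log u/(k+1) − u^{k+1}/(k+1)²]_ε^B` (`0 < ε ≤ B`); (3) `−ε²/3 ≤ ∫₀^ε p(u) log u` for the
cap `p(u) = 2u²/3 − 2u⁴/15 + 4u⁶/315`, `0 < ε ≤ 1`; (4) the Lorentzian moments
`∫₀^B u^{2,4,6}/(A + u²)` for `A = r²`, `r > 0`, in closed form with `arctan (B/r)`;
(5) `(b − a) C/(A + b²) ≤ ∫_a^b C/(A + u²) ≤ (b − a) C/(A + a²)` for `0 ≤ a ≤ b`, `A > 0`, `C ≥ 0`.
Fundamental theorem of calculus with explicit primitives, `integral_log`, and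
`intervalIntegral.integral_mono_on`. [folklore] -/
theorem stub_pieceIntegrals :
    (∀ a b : ℝ, 0 < a → a ≤ b →
        ∫ u in a..b, Real.log u = (b * Real.log b - b) - (a * Real.log a - a)) ∧
      (∀ ε B : ℝ, 0 < ε → ε ≤ B → ∀ k : ℕ,
        ∫ u in ε..B, u ^ k * Real.log u =
          (B ^ (k + 1) * Real.log B / (k + 1) - B ^ (k + 1) / (k + 1) ^ 2) -
            (ε ^ (k + 1) * Real.log ε / (k + 1) - ε ^ (k + 1) / (k + 1) ^ 2)) ∧
      (∀ ε : ℝ, 0 < ε → ε ≤ 1 →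
        -(ε ^ 2 / 3) ≤ ∫ u in (0 : ℝ)..ε,
          (2 / 3 * u ^ 2 - 2 / 15 * u ^ 4 + 4 / 315 * u ^ 6) * Real.log u) ∧
      (∀ A r B : ℝ, 0 < r → r ^ 2 = A → 0 ≤ B →
        (∫ u in (0 : ℝ)..B, u ^ 2 / (A + u ^ 2) = B - r * Real.arctan (B / r)) ∧
          (∫ u in (0 : ℝ)..B, u ^ 4 / (A + u ^ 2) =
            B ^ 3 / 3 - A * B + A * r * Real.arctan (B / r)) ∧
          (∫ u in (0 : ℝ)..B, u ^ 6 / (A + u ^ 2) =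
            B ^ 5 / 5 - A * B ^ 3 / 3 + A ^ 2 * B - A ^ 2 * r * Real.arctan (B / r))) ∧
      (∀ a b C A : ℝ, 0 ≤ a → a ≤ b → 0 < A → 0 ≤ C →
        (∫ u in a..b, C / (A + u ^ 2) ≤ (b - a) * (C / (A + a ^ 2))) ∧
          ((b - a) * (C / (A + b ^ 2)) ≤ ∫ u in a..b, C / (A + u ^ 2))) :=
  ⟨fun a b _ _ => GroundStateSimpleEven.pieces_integral_log a b,
    fun _ _ hε hεB k => GroundStateSimpleEven.pieces_integral_pow_mul_log hε hεB k,
    fun _ hε hε1 => GroundStateSimpleEven.pieces_capLog_tail_ge hε hε1,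
    fun _ _ _ hr hA _ => GroundStateSimpleEven.pieces_integral_lorentzMoments hr hA,
    fun _ _ _ _ ha hab hA hC => GroundStateSimpleEven.pieces_lorentzWindow_bounds ha hab hA hC⟩

end Summit.RiemannHypothesis.RiemannHypothesis.Theorems
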